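import Literature.AnabelianGeometry.SemiGraphs.ArithThm54CapstoneCorollaryTopology
import Literature.AnabelianGeometry.SemiGraphs.ArithThm54DesignInputsNonVacuity
import Literature.AnabelianGeometry.SemiGraphs.ArithPiPresentationOuterCompat
import Literature.AnabelianGeometry.SemiGraphs.GaloisLevelDataOfOpenNormal
import HarnessLib

/-!
# [SemiAnbd] Thm 5.4 (i) ∧ (ii) — the integrated T54-B capstone FIRES HYPOTHESIS-FREE at a concrete
# arithmetic tempered group: `π₁^temp(affWitness p) ⋊^out Aff(ℤ_p)` with the trivial outer action (NON-VACUITY)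

Mochizuki, *Semi-graphs of anabelioids*, Publ. RIMS **42** (2006), §5 Def 5.1 (i) p. 62, Def 5.3 p. 65, Thm 5.4
(i)(ii) p. 66, Prop 5.2 (iv) p. 64 [cite: MochizukiSemiAnbd2006, Thm 5.4 (i) p.66]; Prop 3.6 / Thm 3.7 pp. 38–41.

PROOF-ONLY file (cell abc-iut, layer L3, sub-DAG `plan/L3/SUBDAG-SemiAnbd-Thm54.md`, NV column, row
«T54·NV-capstone@affWitness», seat abc-iut-w6-d099 — the lead's designated T54-binder hand, α79; no definition, no
instance, no new named fact).  abc-iut-w6-d070's integrated corollary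
`arithMaximalCompactStatement_outerAction_piPresentation_levelTopology` (p435643; over abc-iut-w4-d089's
`…_of_producers`, abc-iut-w4-d029's capstones p433251/p433258) proves the typed Thm 5.4 (i) ∧ (ii) at
`E := π₁^temp(𝒢) ⋊^out Π_A` with the LEVEL-B topology pinned, modulo the binder list
`hA · hV hE hopen hBR · hP · hLst · hK1′ · noSwitchBase · stabBranchPairAug · hest · hbot` (and the data `T`, `R`, `Rc`,
`w₀`).  THIS FILE DISCHARGES EVERY ONE OF THEM at the concrete design

  `𝒢 := affWitness p` (the tree's Thm-3.7 witness: one vertex `B(Aff(ℤ_p))`, no edge; abc-iut-w5-d212/w5-d236),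
  `Π_A := Aff(ℤ_p)` (compact, tempered), `ρ' := 1`, `baseAct := 1` (so `E ≅ π₁^temp(𝒢) × Aff(ℤ_p)`),

for EVERY choice of the data (`T`, `R`, `Rc`, `w₀` — all of which exist: `affWitness_capstoneData_nonempty`):
* `hA` — `isTempered_padicAffine`; `hV hE hopen hBR noSwitchBase hest hbot` — abc-iut-w6-d099's
  `ArithThm54DesignInputsNonVacuity` (p433299/p435455; the edge-indexed ones are vacuous here);
* `hP` — abc-iut-w4-d053's `isArithCompatible_piPresentation_outerAction_of_thm37` with its binders `hEI`/`hEc`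
  VACUOUS (no branch, no edge) (`hP_affWitness`);
* `hLst` — at the trivial outer action the `Aut`-component of every `e ∈ E` is INNER (`exists_conj_of_mk_eq`), and
  the level kernels are normal (`hLst_of_trivialOuterAction`, any `𝒢`);
* `hK1′` — at the trivial outer action every `(1, a)`, `a ∈ Π_A`, lies in every level kernel
  (`arithAct_eq_one_of_inner_mem` at `g := 1`), so the `aug`-image of `levelKer` is `⊤`, which is open
  (`levelKer_map_snd_eq_top_of_trivial`, `hK1'_of_trivial`, any presentation / any `𝒢`);
* `stabBranchPairAug` — VACUOUS: the coset semi-graphs of an edgeless `𝒢` have no branch.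
Result: **`arithMaximalCompactStatement_affWitness`** — `ArithMaximalCompactStatementI D aug ∧
ArithMaximalCompactStatementII D aug` for `D := decompositionDataOfChart Rc ι`, `ι`/`aug` the structure maps of
`π₁^temp(affWitness p) ⋊^out Aff(ℤ_p)`, with the canonical LEVEL-B topology, and NO residual hypothesis: the
integrated capstone's full binder list is JOINTLY SATISFIABLE (it was not vacuously conditioned).

HONEST FRAMING: a CONSISTENCY certificate only — the design is edgeless and split, so `hest` / `noSwitchBase` /
`hE` / `hBR` / `stabBranchPairAug` are inhabited vacuously (for a graph with an edge, `hest` fails at every outer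
action with open kernel: abc-iut-w6-d072 p433406, abc-iut-w4-d040 p435609; the contentful design is the
non-split stretch).  The conclusion at this design is correspondingly modest (one conjugacy class of verticial
subgroups, no edge-like ones).  Label (L3-lead α84): [edgeless, ρ = 1: witnessed ≠ endorsed].  Nothing here
bears on [IUTchIII] Cor. 3.12; typed ≠ proved; instantiated ≠ endorsed.
-/

noncomputable section

namespace Literature.AnabelianGeometry.SemiGraphs

open Literature.AnabelianGeometry.EtaleTheta CategoryTheory Topology
open Literature.GroupTheory.SpecificGroups

universe u

/-! ### §1. Generic: the trivial outer action on a subgroup presentation — `levelKer` surjects onto `Π_A` -/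

namespace SemiGraph

namespace SubgroupPresentation

variable {𝔾 : SemiGraph.{u}} {Γ : Type u} [Group Γ] [TopologicalSpace Γ]
  (P : 𝔾.SubgroupPresentation Γ) {PA : Type u} [Group PA]

/-- **At the trivial outer action every `a ∈ Π_A` lifts to the level kernel**: the pair `(1, a)` lies in
`Γ ⋊^out Π_A` (for `ρ = 1`), acts trivially on every coset semi-graph (`arithAct_eq_one_of_inner_mem` at
`g := 1`), has trivial base action (`baseAct = 1`) and is central modulo every level; hence
`levelKer.map aug = ⊤`. [cite: MochizukiSemiAnbd2006, Prop 5.2 (iv), p. 64] -/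
theorem levelKer_map_snd_eq_top_of_trivial
    (hP : P.IsArithCompatible
      (((contMulAut Γ).subtype.comp (MonoidHom.fst (contMulAut Γ) PA)).comp
        (outerSemidirectProduct (1 : PA →* TopOut Γ)).subtype)
      ((1 : PA →* Aut 𝔾).comp (outerSemidirectProductSnd (1 : PA →* TopOut Γ))))
    (K : Subgroup Γ) [K.Normal]
    (hK : ∀ (e : outerSemidirectProduct (1 : PA →* TopOut Γ)) (x : Γ), x ∈ K →
      (((contMulAut Γ).subtype.comp (MonoidHom.fst (contMulAut Γ) PA)).comp
        (outerSemidirectProduct (1 : PA →* TopOut Γ)).subtype) e x ∈ K) :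
    (P.levelKer hP K hK).map (outerSemidirectProductSnd (1 : PA →* TopOut Γ)) = ⊤ := by
  rw [eq_top_iff]
  intro a _
  have ha : ((1 : contMulAut Γ), a) ∈ outerSemidirectProduct (1 : PA →* TopOut Γ) := by
    change TopOut.mk Γ 1 = (1 : PA →* TopOut Γ) a
    rw [map_one, MonoidHom.one_apply]
  refine ⟨⟨((1 : contMulAut Γ), a), ha⟩, (P.mem_levelKer_iff hP K hK).mpr ⟨?_, rfl, fun y => ?_⟩, rfl⟩
  · refine P.arithAct_eq_one_of_inner_mem hP K hK (g := 1) ?_ rfl K.one_mem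
    rw [map_one]
    rfl
  · change ((1 : contMulAut Γ) : MulAut Γ) y * y⁻¹ ∈ K
    rw [OneMemClass.coe_one, MulAut.one_apply, mul_inv_cancel]
    exact K.one_mem

/-- Hence the `aug`-image of the level kernel is OPEN in `Π_A` (it is everything) — the shape of the capstone
binder `hK1′` at the trivial outer action. [cite: MochizukiSemiAnbd2006, Prop 5.2 (iv), p. 64] -/
theorem isOpen_levelKer_map_snd_of_trivial [TopologicalSpace PA]
    (hP : P.IsArithCompatible
      (((contMulAut Γ).subtype.comp (MonoidHom.fst (contMulAut Γ) PA)).comp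
        (outerSemidirectProduct (1 : PA →* TopOut Γ)).subtype)
      ((1 : PA →* Aut 𝔾).comp (outerSemidirectProductSnd (1 : PA →* TopOut Γ))))
    (K : Subgroup Γ) [K.Normal]
    (hK : ∀ (e : outerSemidirectProduct (1 : PA →* TopOut Γ)) (x : Γ), x ∈ K →
      (((contMulAut Γ).subtype.comp (MonoidHom.fst (contMulAut Γ) PA)).comp
        (outerSemidirectProduct (1 : PA →* TopOut Γ)).subtype) e x ∈ K) :
    IsOpen (((P.levelKer hP K hK).map (outerSemidirectProductSnd (1 : PA →* TopOut Γ)) : Subgroup PA) :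
      Set PA) := by
  rw [P.levelKer_map_snd_eq_top_of_trivial hP K hK, Subgroup.coe_top]
  exact isOpen_univ

end SubgroupPresentation

end SemiGraph

/-! ### §2. Generic: at the trivial outer action the `Aut`-components are inner, so normal subgroups are stable -/

section Inner

variable {G : Type u} [Group G] [TopologicalSpace G] {PA : Type u} [Group PA]

/-- **At `ρ = 1` every element of `G ⋊^out Π_A` acts on `G` by an INNER automorphism**, so every normal
subgroup of `G` is stable under it — the shape of the capstone binder `hLst` (Φ-stability of the level kernels)
at the trivial outer action. [cite: MochizukiSemiAnbd2006, §0 p.5] -/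
theorem map_mem_of_normal_of_trivialOuterAction (N : Subgroup G) (hN : N.Normal)
    (e : outerSemidirectProduct (1 : PA →* TopOut G)) (x : G) (hx : x ∈ N) :
    (((contMulAut G).subtype.comp (MonoidHom.fst (contMulAut G) PA)).comp
      (outerSemidirectProduct (1 : PA →* TopOut G)).subtype) e x ∈ N := by
  have he : TopOut.mk G (1 : contMulAut G) = TopOut.mk G e.1.1 := by
    rw [map_one, mk_fst_eq_rho_snd, MonoidHom.one_apply]
  obtain ⟨g, hg⟩ := exists_conj_of_mk_eq (1 : contMulAut G) e.1.1 he
  change ((e.1.1 : contMulAut G) : MulAut G) x ∈ N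
  rw [hg x, OneMemClass.coe_one, MulAut.one_apply]
  exact hN.conj_mem x hx g

end Inner

namespace ProfiniteSemiGraph

/-! ### §3. Generic over `𝒢` with Thm-3.7 hypotheses: `hLst` and `hK1′` at the trivial outer action -/

section TrivialRho

variable {𝒢 : ProfiniteSemiGraph.{u}} (h37 : 𝒢.Thm37Hypotheses) (PA : Type u) [Group PA]

/-- **The capstone binder `hLst` at the trivial outer action** (any `𝒢`, canonical tower): the kernels of the
finite-level projections `piLevelAut n` are normal, hence stable under the (inner) `Aut`-components of
`π₁^temp(𝒢) ⋊^out Π_A` for `ρ' = 1`. [cite: MochizukiSemiAnbd2006, Prop 5.2 (iv), p. 64] -/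
theorem hLst_of_trivialOuterAction :
    ∀ (n : ℕ) (e : outerSemidirectProduct (1 : PA →* TopOut (𝒢.temperedPiChart h37.toProp36Hypotheses).G))
      (x : (𝒢.temperedPiChart h37.toProp36Hypotheses).G),
      x ∈ ((𝒢.galoisLevelData h37.toProp36Hypotheses).piLevelAut h37.toProp36Hypotheses.isCountable
        (𝒢.galoisLevelData_hconn h37.toProp36Hypotheses) n).ker →
      (((contMulAut (𝒢.temperedPiChart h37.toProp36Hypotheses).G).subtype.comp
        (MonoidHom.fst (contMulAut (𝒢.temperedPiChart h37.toProp36Hypotheses).G) PA)).comp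
        (outerSemidirectProduct (1 : PA →* TopOut (𝒢.temperedPiChart h37.toProp36Hypotheses).G)).subtype) e x ∈
      ((𝒢.galoisLevelData h37.toProp36Hypotheses).piLevelAut h37.toProp36Hypotheses.isCountable
        (𝒢.galoisLevelData_hconn h37.toProp36Hypotheses) n).ker :=
  fun _ e x hx => map_mem_of_normal_of_trivialOuterAction _ (MonoidHom.normal_ker _) e x hx

end TrivialRho

/-! ### §4. The integrated capstone at `affWitness p`, `Π_A := Aff(ℤ_p)`, `ρ' := 1`: every binder discharged -/

section AffWitness

variable (p : ℕ) [Fact p.Prime]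

/-- The capstone binder `hP` at `affWitness p` with the trivial outer action: abc-iut-w4-d053's
`isArithCompatible_piPresentation_outerAction_of_thm37` with `hV` from the trivial action and its two
remaining inputs `hEI` (branch pairs) and `hEc` (edge conjugators) VACUOUS — `affWitness p` has no branch and
no edge. [cite: MochizukiSemiAnbd2006, Thm 5.4, p. 66] -/
theorem hP_affWitness
    (T : ∀ w : (affWitness p).graph.Vertex,
      ((affWitness p).galoisLevelData (affWitness_thm37Hypotheses (p := p)).toProp36Hypotheses).PointSeq
        (affWitness_thm37Hypotheses (p := p)).toProp36Hypotheses.isCountable w)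
    (R : SemiGraph.RefBranches (affWitness p).graph) :
    (((affWitness p).galoisLevelData (affWitness_thm37Hypotheses (p := p)).toProp36Hypotheses).piPresentation
        (affWitness_thm37Hypotheses (p := p)).toProp36Hypotheses.isCountable T R).IsArithCompatible
      (((contMulAut ((affWitness p).temperedPiChart
          (affWitness_thm37Hypotheses (p := p)).toProp36Hypotheses).G).subtype.comp
        (MonoidHom.fst _ (PadicAffine p))).comp
        (outerSemidirectProduct (1 : PadicAffine p →* TopOut ((affWitness p).temperedPiChart
          (affWitness_thm37Hypotheses (p := p)).toProp36Hypotheses).G)).subtype)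
      ((1 : PadicAffine p →* Aut (affWitness p).graph).comp
        (outerSemidirectProductSnd (1 : PadicAffine p →* TopOut ((affWitness p).temperedPiChart
          (affWitness_thm37Hypotheses (p := p)).toProp36Hypotheses).G))) :=
  isArithCompatible_piPresentation_outerAction_of_thm37 1 R (affWitness_thm37Hypotheses (p := p)) T 1
    (hV_of_trivialOuterAction _ (PadicAffine p)) (affWitness_isGraph p) (fun b => nomatch b)
    (fun _ ε => nomatch ε)

/-- The capstone binder `hK1′` at `affWitness p` with the trivial outer action (for ANY compatible `hP` and any
Φ-stability witness): the `aug`-image of every level kernel is all of `Aff(ℤ_p)`, hence open.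
[cite: MochizukiSemiAnbd2006, Prop 5.2 (iv), p. 64] -/
theorem hK1'_affWitness
    (T : ∀ w : (affWitness p).graph.Vertex,
      ((affWitness p).galoisLevelData (affWitness_thm37Hypotheses (p := p)).toProp36Hypotheses).PointSeq
        (affWitness_thm37Hypotheses (p := p)).toProp36Hypotheses.isCountable w)
    (R : SemiGraph.RefBranches (affWitness p).graph) (n : ℕ) :
    IsOpen ((((((affWitness p).galoisLevelData (affWitness_thm37Hypotheses (p := p)).toProp36Hypotheses).piPresentation
        (affWitness_thm37Hypotheses (p := p)).toProp36Hypotheses.isCountable T R).levelKer (hP_affWitness p T R)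
        (((affWitness p).galoisLevelData (affWitness_thm37Hypotheses (p := p)).toProp36Hypotheses).projAut
          (affWitness_thm37Hypotheses (p := p)).toProp36Hypotheses.isCountable n).ker
        (((affWitness p).galoisLevelData (affWitness_thm37Hypotheses (p := p)).toProp36Hypotheses).hKst_of_hLst_outerAction
          (affWitness_thm37Hypotheses (p := p)).toProp36Hypotheses.isCountable
          ((affWitness p).galoisLevelData_hconn (affWitness_thm37Hypotheses (p := p)).toProp36Hypotheses) T R 1
          (hP_affWitness p T R) (hLst_of_trivialOuterAction (affWitness_thm37Hypotheses (p := p)) (PadicAffine p)) n)).map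
        (outerSemidirectProductSnd (1 : PadicAffine p →* TopOut ((affWitness p).temperedPiChart
          (affWitness_thm37Hypotheses (p := p)).toProp36Hypotheses).G)) : Subgroup (PadicAffine p)) :
      Set (PadicAffine p)) :=
  haveI := MonoidHom.normal_ker (((affWitness p).galoisLevelData
    (affWitness_thm37Hypotheses (p := p)).toProp36Hypotheses).projAut
    (affWitness_thm37Hypotheses (p := p)).toProp36Hypotheses.isCountable n)
  SemiGraph.SubgroupPresentation.isOpen_levelKer_map_snd_of_trivial _ (hP_affWitness p T R) _ _

/-- **The data of the capstone exist at `affWitness p`**: compatible point sequences over the (one) vertex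
(`GaloisLevelData.nonempty_pointSeq_of_isConnected`), reference branches (no edge: nothing to choose), chart
representatives (`ChartRepresentatives.nonempty`), a base vertex — so the universally quantified statement below
is not vacuous. [cite: MochizukiSemiAnbd2006, Thm 3.7 (i), p. 40] -/
theorem affWitness_capstoneData_nonempty :
    (∀ w : (affWitness p).graph.Vertex, Nonempty
      (((affWitness p).galoisLevelData (affWitness_thm37Hypotheses (p := p)).toProp36Hypotheses).PointSeq
        (affWitness_thm37Hypotheses (p := p)).toProp36Hypotheses.isCountable w)) ∧
    Nonempty (SemiGraph.RefBranches (affWitness p).graph) ∧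
    Nonempty (ChartRepresentatives ((affWitness p).temperedPiChart
      (affWitness_thm37Hypotheses (p := p)).toProp36Hypotheses)) ∧
    Nonempty (affWitness p).graph.Vertex :=
  ⟨fun w => GaloisLevelData.nonempty_pointSeq_of_isConnected _ _ (affWitness_isConnected (p := p)) w,
    ⟨⟨(fun e => nomatch e), (fun e => nomatch e), (fun e => nomatch e), (fun e => nomatch e)⟩⟩,
    ChartRepresentatives.nonempty _ (affWitness_isGraph p) (affWitness_isQuasiCoherent (p := p))
      (affWitness_isGaloisCountable (p := p)) (affWitness_isOfInjectiveType (p := p)),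
    ⟨PUnit.unit⟩⟩

/-- **[SemiAnbd] Thm 5.4 (i) ∧ (ii), INTEGRATED CAPSTONE, HYPOTHESIS-FREE AT A CONCRETE DESIGN** — the
non-vacuity certificate of the T54-B binder list.  At `𝒢 := affWitness p`, `Π_A := Aff(ℤ_p)`, trivial outer
action and base action, canonical LEVEL-B topology on `E = π₁^temp(𝒢) ⋊^out Aff(ℤ_p)` (pinned by `hinst`, as in the
corollary), for EVERY choice of the data `T`, `R`, `Rc`, `w₀`: the typed conclusions `ArithMaximalCompactStatementI`
and `ArithMaximalCompactStatementII` of Thm 5.4 hold for the produced decomposition data — with NO residual binder.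
HONEST: consistency only (edgeless, split design; `hest`, `noSwitchBase`, `hE`, `hBR`, `stabBranchPairAug`
vacuous). [cite: MochizukiSemiAnbd2006, Thm 5.4 (i), p. 66] -/
theorem arithMaximalCompactStatement_affWitness
    (T : ∀ w : (affWitness p).graph.Vertex,
      ((affWitness p).galoisLevelData (affWitness_thm37Hypotheses (p := p)).toProp36Hypotheses).PointSeq
        (affWitness_thm37Hypotheses (p := p)).toProp36Hypotheses.isCountable w)
    (R : SemiGraph.RefBranches (affWitness p).graph)
    (Rc : ChartRepresentatives ((affWitness p).temperedPiChart (affWitness_thm37Hypotheses (p := p)).toProp36Hypotheses))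
    (w₀ : (affWitness p).graph.Vertex)
    [inst : TopologicalSpace (outerSemidirectProduct (1 : PadicAffine p →* TopOut ((affWitness p).temperedPiChart
      (affWitness_thm37Hypotheses (p := p)).toProp36Hypotheses).G))]
    (hinst : inst = canonicalArithLevelTopology (affWitness_thm37Hypotheses (p := p)) isTempered_padicAffine 1 1 T R
      (hP_affWitness p T R) w₀ (hLst_of_trivialOuterAction (affWitness_thm37Hypotheses (p := p)) (PadicAffine p))
      (hK1'_affWitness p T R)) :
    ArithMaximalCompactStatementI
        (decompositionDataOfChart Rc (toOuterSemidirectProduct (1 : PadicAffine p →* TopOut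
          ((affWitness p).temperedPiChart (affWitness_thm37Hypotheses (p := p)).toProp36Hypotheses).G)))
        (outerSemidirectProductSnd (1 : PadicAffine p →* TopOut
          ((affWitness p).temperedPiChart (affWitness_thm37Hypotheses (p := p)).toProp36Hypotheses).G)) ∧
      ArithMaximalCompactStatementII
        (decompositionDataOfChart Rc (toOuterSemidirectProduct (1 : PadicAffine p →* TopOut
          ((affWitness p).temperedPiChart (affWitness_thm37Hypotheses (p := p)).toProp36Hypotheses).G)))
        (outerSemidirectProductSnd (1 : PadicAffine p →* TopOut
          ((affWitness p).temperedPiChart (affWitness_thm37Hypotheses (p := p)).toProp36Hypotheses).G)) := by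
  haveI : IsEmpty (affWitness p).graph.Edge := ⟨fun e => nomatch e⟩
  haveI : Finite (affWitness p).graph.Vertex := (show Finite PUnit.{1} from inferInstance)
  haveI : Finite (affWitness p).graph.Branch := (show Finite PEmpty.{1} from inferInstance)
  refine arithMaximalCompactStatement_outerAction_piPresentation_levelTopology
    (affWitness_thm37Hypotheses (p := p)) (affWitness_isGraph p) isTempered_padicAffine 1 1 T R Rc
    (hV_of_trivialOuterAction _ (PadicAffine p)) (hE_of_trivialOuterAction _ (PadicAffine p))
    (hopen_of_trivialBaseAct (𝒢 := affWitness p) (PadicAffine p))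
    (hBR_of_trivialOuterAction _ (PadicAffine p)) (hP_affWitness p T R) w₀
    (hLst_of_trivialOuterAction (affWitness_thm37Hypotheses (p := p)) (PadicAffine p)) (hK1'_affWitness p T R)
    hinst (noBranchSwitching_of_trivialBaseAct (𝒢 := affWitness p) (PadicAffine p)) ?_
    (isTotallyArithEstranged_decompositionDataOfChart_of_isEmpty _ (PadicAffine p) Rc _ _)
    (not_isArithAmple_bot_of_not_isOpen_singleton_one (PadicAffine p)
      (not_isOpen_singleton_one_padicAffine p) _)
  -- `stabBranchPairAug` is vacuous: the coset semi-graphs of the edgeless `affWitness p` have no branch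
  intro C _ j₀ _ β
  exact (nomatch (β ⟨j₀, le_rfl⟩).1.1 : _)

end AffWitness

end ProfiniteSemiGraph

end Literature.AnabelianGeometry.SemiGraphs

end
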